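import Summits.BirchSwinnertonDyer.BirchSwinnertonDyer.Theorems.Rank2ObservatoryAnomHeightFree
import Summits.BirchSwinnertonDyer.BirchSwinnertonDyer.Theorems.Rank2ObservatoryPadicAtlasP3R2A00
import Literature.NumberTheory.EllipticCurves.Wuthrich2014.ThreeAdicImageOrdinaryProofs
import HarnessLib

/-!
# BirchSwinnertonDyer — rank ≥ 2 observatory: the height-free `Ш[p^∞] = 0` theorem at an ODD good ordinary prime (`p = 3`)

HONEST FRAMING: per-curve certified theorems and census instruments; no claim on BSD in rank ≥ 2.

The height-free unit-cell theorem of the observatory (`Rank2ObservatoryAnomHeightFree.lean`: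
`sha_card_eq_one_heightFree`, `AtlasCurve.heightFreeRow` — GIVEN Kato's divisibility, Perrin-Riou–Schneider,
the newform and the symbol DATA of a kernel-certified atlas cell whose leading coefficient `[T^r] L_p` is a
`p`-adic UNIT at a NON-ANOMALOUS prime, plus the census bits `Surj(E, p)`, `p ∤ ∏c_ℓ`, admissible multiples:
`#Ш(E/ℚ)[p^∞] = 1` and `ord_p Reg_p = r`, no height computed) is stated at `p ≥ 5` for two reasons only:
the canonical height datum came from `exists_isCanonical_holds` (`5 ≤ p`) and `ρ̄_{E,p^n}` onto for all `n`
came from Serre's `p ≥ 5` lifting (`serre_hasSurjectiveModNGaloisRep_pow_holds`). Both have odd-prime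
forms IN THE TREE: the THEOREM `exists_isCanonical_of_odd` from the named fact `mazur_tate_sigma_exists_odd`
(MST 2006 Thm. 1.3; `PadicSigmaOddPrime.lean`, equivalent to its `p = 3` instance given the tree), and the
THEOREM `WeierstrassCurve.forall_hasSurjectiveModNGaloisRep_pow_of_goodOrdinary_of_surj`
(`Wuthrich2014/ThreeAdicImageOrdinaryProofs.lean`: odd good ORDINARY `p`, `ρ̄_{E,p}` onto ⇒ `ρ̄_{E,p^n}` onto;
at `p = 3` this is Wuthrich 2014 Lemma 20, PROVED there) — so the census hypothesis stays the single bit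
`Surj W p`. The closing inequality `sha_card_eq_one_of_unit_leadingCoeff` and the kernel squeeze
`norm_coeff_eq_one_of_symbolCertL` are typed for every odd `p` already, and the cell seats' odd kit
`Rank2ObservatoryPadicAtlasKitOdd.lean` (`AtlasCell.checkOdd`, `AtlasCurve.padicRowOdd`, p252422) with its
20 two-engine `3`-adic atlas parts `Rank2ObservatoryPadicAtlasP3R2A00…19.lean` (730 cells `(E, 3)`) supplies
the row. This file adds the `p = 3` HEIGHT-FREE consequence on top of that kit — nothing of the kit is
restated:

* §1 `sha_card_eq_one_heightFree_odd` — `sha_card_eq_one_heightFree` with `5 ≤ p` replaced by `p ≠ 2` and the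
  extra named input `hex : mazur_tate_sigma_exists_odd`;
* §2 `AtlasCurve.heightFreeRowOdd` — the height-free row of a UNIT cell (`AtlasCell.unitCheck`: `p ∤ A·H − L`,
  `p ∤ a_p − 1`) of an odd-checking atlas curve (data consumers discharge `hlow` by their table's census rank theorem and
  the instances by `isElliptic_of_mem_…` / `isGloballyMinimal_of_mem_…`, as in §3);
* §3 exemplar `563a1` at `p = 3` (part `P3R2A00`: `a_3 = −1`, `n = 1`, `A = 2`, `H = 2`, `L = 0`, so
  `A·H − L = 4`, a `3`-adic unit, non-anomalous): `rank = 2` and `#Ш(563a1/ℚ)[3^∞] = 1`, `ord_3 Reg_3 = 2`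
  GIVEN the named facts, the newform, the symbol DATA and the census bits — `2 ≤ rank` is NOT a hypothesis
  (tree theorem `two_le_rank_of_mem_atlasP3R2A00`).

Which `p = 3` cells are served (instrument J15 of the joins seat, `CONSISTENCY-JOINS.md §J15`): unit,
non-anomalous (`a_3 = −1` or `2`), `3 ∤ ∏c_ℓ`, `ρ̄_{E,3}` onto (census: Cremona–Sutherland galrep table AND
the `S₄` Frobenius-cycle certificate of the 3-division quartic), i.e. 209 unit non-anomalous cells of 730
before the census filters. Rank 3 is not served at `p = 3` (`validL` needs `p ∤ r!`).
HYPOTHESES LEDGER of a height-free `p = 3` row: named facts `hS` (odd PRS, BMS Thm. 1.7 at its printed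
generality `p > 2`), `hex` (`σ` exists), `hkato` (Kato 17.4); the newform `hf`; symbol DATA `hint`/`htab`
(`‖D‖_3 = 1`; two-engine tables); census `hsurj`, `htam`, `hm`/`hadm`; KERNEL-DECIDED `checkOdd`, `minCheck`,
`unitCheck`; PROVED `2 ≤ rank`. Per cell; NOT a class theorem; no census verdict changes. No `sorry`, no new
axioms.

References: Kato, Astérisque 295 (2004) Thm. 17.4; Balakrishnan–Müller–Stein, Math. Comp. 85 (2016) Thm. 1.7
and p. 3; Mazur–Stein–Tate, Doc. Math. Extra Vol. (2006) Thm. 1.3; Balakrishnan, JNT 161 (2016) §2; Wuthrich,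
JNT 135 (2014) Lemma 20; Mazur–Tate–Teitelbaum, Invent. Math. 84 (1986) §I.10–13; Stein–Wuthrich, Math. Comp.
82 (2013) §4.1, Alg. 11.1; Cremona, Algorithms (1997) Table 1, §3.5.
-/

open scoped Classical MatrixGroups ModularForm

open CongruenceSubgroup WeierstrassCurve Literature.NumberTheory.EllipticCurves
  Literature.NumberTheory.EllipticCurves.ModularForms Literature.NumberTheory.EllipticCurves.Rank1Residual

-- single-conjunct summit: `Summit.BirchSwinnertonDyer.BirchSwinnertonDyer.…` repeats the name by design
set_option linter.dupNamespace false

namespace Summit.BirchSwinnertonDyer.BirchSwinnertonDyer.Rank2Observatory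

/-! ## §1. `Ш[p^∞] = 0` and `ord_p Reg_p = r`, height-free, at an odd good ordinary prime -/

/-- **HEIGHT-FREE `#Ш(E/ℚ)[p^∞] = 1` at an ODD good ordinary prime with the census hypothesis `Surj W p`**
(`sha_card_eq_one_heightFree` with `5 ≤ p` replaced by `p ≠ 2`): `ρ̄_{E,p^n}` is onto for every `n` by the
THEOREM `forall_hasSurjectiveModNGaloisRep_pow_of_goodOrdinary_of_surj` (at `p = 3`: Wuthrich 2014 Lemma 20),
THE canonical height exists by `exists_isCanonical_of_odd` (`hex`); conclusion `#Ш(E/ℚ)[p^∞] = 1` and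
`ord_p Reg_p(E, Dh) = r`, `‖Reg_p‖ = p^{-r}` for EVERY canonical `Dh`. Per curve; NOT a class theorem.
[cite: Kato2004Asterisque, Thm. 17.4 (3) (p. 273)] [cite: BalakrishnanMullerStein2015, Thm. 1.7]
[cite: Wuthrich2014, Lemma 20 (p. 399)] [cite: MazurSteinTate2006, Thm. 1.3]
[cite: SteinWuthrich2013, §4.1 and Alg. 11.1] -/
theorem sha_card_eq_one_heightFree_odd
    (hS : Schneider1985_order_charGenerator_odd) (hex : mazur_tate_sigma_exists_odd)
    (W : WeierstrassCurve ℚ) [W.IsElliptic] [W.IsGloballyMinimal] (p : ℕ) [Fact p.Prime]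
    {N : ℕ} [NeZero N] (f : CuspForm (Gamma0 N) 2)
    (hK : ∀ (κ : ZpExtension ℚ p) (γ : Field.absoluteGaloisGroup ℚ),
      kato_divisibility W p (κ := κ) (γ := γ) (f := f))
    (hp : p ≠ 2) (hgood : W.HasGoodReductionAtPrime p) (hordp : ¬ (p : ℤ) ∣ W.frobeniusTrace p)
    (hsurj : Surj W p) (hf : IsNewformOf W f)
    (hord : (padicLFunction f (unitRoot W p : ℚ_[p])).order = W.mordellWeilRank)
    (hcoeff : ‖PowerSeries.coeff W.mordellWeilRank (padicLFunction f (unitRoot W p : ℚ_[p]))‖ = 1)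
    (hna : ¬ (p : ℤ) ∣ W.frobeniusTrace p - 1) (htam : ¬ p ∣ W.tamagawaProduct)
    {m : ℕ} (hm : ¬ p ∣ m)
    (hadm : ∀ P : W.toAffine.Point, ¬ IsOfFinAddOrder P → W.IsAdmissible p (m • P)) :
    Nat.card (AddCommGroup.primaryComponent W.sha p) = 1 ∧
      ∀ Dh : PAdicHeightData W p, Dh.IsCanonical →
        (padicRegulator Dh).valuation = W.mordellWeilRank ∧
          ‖padicRegulator Dh‖ = ((p : ℝ)⁻¹) ^ W.mordellWeilRank := by
  have hsurjpow : ∀ n : ℕ, W.HasSurjectiveModNGaloisRep (p ^ n : ℕ) :=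
    W.forall_hasSurjectiveModNGaloisRep_pow_of_goodOrdinary_of_surj p hp hgood hordp hsurj
  obtain ⟨Dh₀, hDh₀⟩ := exists_isCanonical_of_odd hex W p hp hgood hordp
  refine ⟨(sha_card_eq_one_of_unit_leadingCoeff hS W p f hK hp hgood hordp hsurjpow hf Dh₀ hDh₀ hord
    hcoeff hna htam hm hadm).1, fun Dh hDh => ?_⟩
  exact (sha_card_eq_one_of_unit_leadingCoeff hS W p f hK hp hgood hordp hsurjpow hf Dh hDh hord
    hcoeff hna htam hm hadm).2

/-! ## §2. The height-free row of a unit cell of an odd-checking atlas curve -/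
namespace AtlasCurve

variable {C : AtlasCurve}

/-- **The HEIGHT-FREE row of a unit cell at an ODD good ordinary prime** (`AtlasCurve.heightFreeRow` with
the odd inputs `hS`, `hex` of `Rank2ObservatoryPadicAtlasKitOdd.lean`): for an odd-checking curve `C`, a cell `c ∈ C.cells` passing `unitCheck`
(`p ∤ A·H − L`, `p ∤ a_p − 1`), GIVEN `hkato`, `hf`, `hlow`, the symbol DATA `hint`/`htab`, the census `Surj`
at `p`, `p ∤ ∏c_ℓ` and `p`-primitive admissible multiples: `rank E(ℚ) = 2`, `#Ш(E/ℚ)[p^∞] = 1`, and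
`ord_p Reg_p(E, Dh) = 2`, `‖Reg_p‖ = p⁻²` for every canonical `Dh` — no height, regulator or generator
computed. Per cell; NOT a class theorem. [cite: Kato2004Asterisque, Thm. 17.4 (3) (p. 273)]
[cite: BalakrishnanMullerStein2015, Thm. 1.7] [cite: MazurTateTeitelbaum1986Invent, §I.10–I.13]
[cite: Wuthrich2014, Lemma 20 (p. 399)] [cite: SteinWuthrich2013, §4.1 and Alg. 11.1] -/
theorem heightFreeRowOdd (h : C.checkOdd = true) {c : AtlasCell} (hc : c ∈ C.cells)
    (hu : c.unitCheck = true) [Fact c.p.Prime]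
    [(C.e.baseChange ℚ).IsElliptic] [(C.e.baseChange ℚ).IsGloballyMinimal]
    (hS : Schneider1985_order_charGenerator_odd) (hex : mazur_tate_sigma_exists_odd)
    {N : ℕ} [NeZero N] {f : CuspForm (Gamma0 N) 2} (hf : IsNewformOf (C.e.baseChange ℚ) f)
    (hkato : ∀ (κ : ZpExtension ℚ c.p) (γ : Field.absoluteGaloisGroup ℚ),
      kato_divisibility (C.e.baseChange ℚ) c.p (κ := κ) (γ := γ) (f := f))
    (hlow : 2 ≤ C.row.curve.mordellWeilRank) (D : ℚ) (hD : ‖(D : ℚ_[c.p])‖ = 1)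
    (hint : ∀ x : ℚ, ‖(ratPlusSymbol f x : ℚ_[c.p])‖ ≤ 1)
    (htab : ∀ u : ℕ, u < c.p ^ (c.n + 1) → ¬ c.p ∣ u →
      ratPlusSymbol f ((u : ℚ) / (c.p : ℚ) ^ (c.n + 1)) = (c.tabHi.getD u 0 : ℚ) / D ∧
      ratPlusSymbol f ((u : ℚ) / (c.p : ℚ) ^ c.n) = (c.tabLo.getD (u % c.p ^ c.n) 0 : ℚ) / D)
    (hsurj : Surj (C.e.baseChange ℚ) c.p) (htam : ¬ c.p ∣ (C.e.baseChange ℚ).tamagawaProduct)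
    {m : ℕ} (hm : ¬ c.p ∣ m)
    (hadm : ∀ P : (C.e.baseChange ℚ).toAffine.Point, ¬ IsOfFinAddOrder P →
      (C.e.baseChange ℚ).IsAdmissible c.p (m • P)) :
    C.row.curve.mordellWeilRank = 2 ∧
      Nat.card (AddCommGroup.primaryComponent (C.e.baseChange ℚ).sha c.p) = 1 ∧
      ∀ Dh : PAdicHeightData (C.e.baseChange ℚ) c.p, Dh.IsCanonical →
        (padicRegulator Dh).valuation = 2 ∧ ‖padicRegulator Dh‖ = ((c.p : ℝ)⁻¹) ^ 2 := by
  have hk : c.checkOdd C.e = true := cell_checkOdd h hc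
  have hp : c.p ≠ 2 := (AtlasCell.sound_of_checkOdd hk).2.1
  obtain ⟨hap, hordin, hv⟩ := AtlasCell.rowInputs_of_checkOdd (e := C.e) hk
  obtain ⟨hr, ho, -, -, -⟩ := C.padicRowOdd h hc hS hex hf hkato hlow D hD hint htab
  have hrank : (C.e.baseChange ℚ).mordellWeilRank = 2 := by rw [baseChange_e]; exact hr
  have htab' : ∀ u : ℕ, u < c.p ^ (c.certL.n + 1) → ¬ c.p ∣ u →
      ratPlusSymbol f ((u : ℚ) / (c.p : ℚ) ^ (c.certL.n + 1)) = (c.certL.tabHi.getD u 0 : ℚ) / D ∧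
      ratPlusSymbol f ((u : ℚ) / (c.p : ℚ) ^ c.certL.n) = (c.certL.tabLo.getD u 0 : ℚ) / D :=
    fun u hu' hpu => by
      rw [AtlasCell.certL_tabLo_getD c hu']
      exact htab u hu' hpu
  have hcoeff := norm_coeff_eq_one_of_symbolCertL c.p (C.e.baseChange ℚ) hordin hf hap c.certL hv
    (AtlasCell.unitL_of_unitCheck hu) D hD hint htab'
  have hcoeff' : ‖PowerSeries.coeff (C.e.baseChange ℚ).mordellWeilRank
      (padicLFunction f (unitRoot (C.e.baseChange ℚ) c.p : ℚ_[c.p]))‖ = 1 := by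
    rw [hrank]; exact hcoeff
  have hord : (padicLFunction f (unitRoot (C.e.baseChange ℚ) c.p : ℚ_[c.p])).order =
      (C.e.baseChange ℚ).mordellWeilRank := by rw [hrank]; exact ho
  have hna : ¬ ((c.p : ℤ) ∣ (C.e.baseChange ℚ).frobeniusTrace c.p - 1) := by
    rw [hap]; exact AtlasCell.not_dvd_ap_sub_one_of_unitCheck hu
  obtain ⟨hsha, hreg⟩ := sha_card_eq_one_heightFree_odd hS hex (C.e.baseChange ℚ) c.p f hkato hp
    hordin.1 hordin.2 hsurj hf hord hcoeff' hna htam hm hadm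
  refine ⟨hr, hsha, fun Dh hDh => ?_⟩
  have := hreg Dh hDh
  rw [hrank] at this
  exact_mod_cast this

end AtlasCurve

/-! ## §3. Exemplar: `563a1` at `p = 3` (part `P3R2A00`) -/

/-- **Exemplar (kernel, `decide`)**: the `3`-adic cell of `563a1` is a UNIT cell — `3 ∤ A·H − L = 4` and
`3 ∤ a_3 − 1 = −2`. [cite: MazurTateTeitelbaum1986Invent, §I.10–I.13] -/
theorem unitCheck_c563a1p3 : (c563a1p3.cells.all fun c => c.unitCheck) = true := by
  decide

/-- The two kernel tests of `563a1` at `p = 3` (from the atlas certificate `c563a1p3_ok`). [folklore] -/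
theorem check_c563a1p3 : c563a1p3.checkOdd = true ∧ c563a1p3.minCheck = true := by
  simpa only [Bool.and_eq_true] using c563a1p3_ok

/-- `563a1` is a curve of the landed table `atlasP3R2A00`. [folklore] -/
theorem c563a1p3_mem : c563a1p3 ∈ atlasP3R2A00 := by
  simp only [atlasP3R2A00, List.mem_cons, true_or, or_true]

/-- `563a1 ⊗ ℚ` is elliptic (kernel: `Δ ≠ 0`). [folklore] -/
instance isElliptic_c563a1p3 : (c563a1p3.e.baseChange ℚ).IsElliptic :=
  AtlasCurve.isElliptic_odd check_c563a1p3.1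

/-- The integer model of `563a1` is globally minimal (kernel: `minCheck`). [cite: SilvermanAEC2009, VII.1 Remark 1.1] -/
instance isGloballyMinimal_c563a1p3 : (c563a1p3.e.baseChange ℚ).IsGloballyMinimal :=
  AtlasCurve.isGloballyMinimal check_c563a1p3.2

/-- **`563a1` at `p = 3`, height-free and rank-free** (`AtlasCurve.heightFreeRowOdd`; `2 ≤ rank` from the tree
theorem `two_le_rank_of_mem_atlasP3R2A00`): GIVEN the named facts `hS`, `hex`, Kato `hkato`, the newform `hf`,
the symbol DATA `hint`/`htab` (`D = 2`), the census bits `Surj(563a1, 3)` (galrep: no exceptional prime),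
`3 ∤ ∏c_ℓ = 1`, and `3`-primitive admissible multiples (`m = #Ẽ(𝔽_3)·∏c_ℓ = 5`): `rank 563a1(ℚ) = 2`,
`#Ш(563a1/ℚ)[3^∞] = 1`, `ord_3 Reg_3 = 2` for every canonical datum. BSD predicts `#Ш = 1` (`S = 1.000`,
census). [cite: Kato2004Asterisque, Thm. 17.4 (3) (p. 273)] [cite: BalakrishnanMullerStein2015, Thm. 1.7]
[cite: Wuthrich2014, Lemma 20 (p. 399)] [cite: CremonaAlgorithms1997, Table 1] -/
theorem heightFreeRow_c563a1p3 {c : AtlasCell} (hc : c ∈ c563a1p3.cells) [Fact c.p.Prime]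
    (hS : Schneider1985_order_charGenerator_odd) (hex : mazur_tate_sigma_exists_odd)
    {N : ℕ} [NeZero N] {f : CuspForm (Gamma0 N) 2} (hf : IsNewformOf (c563a1p3.e.baseChange ℚ) f)
    (hkato : ∀ (κ : ZpExtension ℚ c.p) (γ : Field.absoluteGaloisGroup ℚ),
      kato_divisibility (c563a1p3.e.baseChange ℚ) c.p (κ := κ) (γ := γ) (f := f))
    (D : ℚ) (hD : ‖(D : ℚ_[c.p])‖ = 1)
    (hint : ∀ x : ℚ, ‖(ratPlusSymbol f x : ℚ_[c.p])‖ ≤ 1)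
    (htab : ∀ u : ℕ, u < c.p ^ (c.n + 1) → ¬ c.p ∣ u →
      ratPlusSymbol f ((u : ℚ) / (c.p : ℚ) ^ (c.n + 1)) = (c.tabHi.getD u 0 : ℚ) / D ∧
      ratPlusSymbol f ((u : ℚ) / (c.p : ℚ) ^ c.n) = (c.tabLo.getD (u % c.p ^ c.n) 0 : ℚ) / D)
    (hsurj : Surj (c563a1p3.e.baseChange ℚ) c.p) (htam : ¬ c.p ∣ (c563a1p3.e.baseChange ℚ).tamagawaProduct)
    {m : ℕ} (hm : ¬ c.p ∣ m)
    (hadm : ∀ P : (c563a1p3.e.baseChange ℚ).toAffine.Point, ¬ IsOfFinAddOrder P →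
      (c563a1p3.e.baseChange ℚ).IsAdmissible c.p (m • P)) :
    c563a1p3.row.curve.mordellWeilRank = 2 ∧
      Nat.card (AddCommGroup.primaryComponent (c563a1p3.e.baseChange ℚ).sha c.p) = 1 ∧
      ∀ Dh : PAdicHeightData (c563a1p3.e.baseChange ℚ) c.p, Dh.IsCanonical →
        (padicRegulator Dh).valuation = 2 ∧ ‖padicRegulator Dh‖ = ((c.p : ℝ)⁻¹) ^ 2 :=
  AtlasCurve.heightFreeRowOdd check_c563a1p3.1 hc (List.all_eq_true.mp unitCheck_c563a1p3 c hc) hS hex hf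
    hkato (two_le_rank_of_mem_atlasP3R2A00 c563a1p3_mem) D hD hint htab hsurj htam hm hadm

end Summit.BirchSwinnertonDyer.BirchSwinnertonDyer.Rank2Observatory
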